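import Literature.Computability.Complexity.ThresholdGadgets
import Literature.Computability.Complexity.CircuitRestriction
import Summits.PneNP.PneNP.Theorems.SymmetryBudgetWindowCanoniserNodesDefs

/-!
# Window canoniser, II (continued): formula gates, the gate type and the gate functions (definitions)

Route `PneNP/SymmetryBudget`, dichotomy `WindowBarrier` (stmt-PneNP-2145) / `NoHiddenOrder` (stmt-PneNP-14781);
continuation of `…WindowCanoniserNodesDefs.lean` (see its module docstring for the design).  Here: literals,
the width-8 and width-4 formula layers `WCan.N1`/`WCan.N2`, the gate type `WCan.Node`, the wires, the
relabelling action on gates, and the gate function of every gate (`WCan.Node.fn`, all in `tcBasis`, all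
symmetric).
-/

-- `Summit.PneNP.PneNP.…` duplicates `PneNP` BY DESIGN (single-problem summit, D-0017 layout).
set_option linter.dupNamespace false

namespace Summit.PneNP.PneNP.Theorems

namespace WCan

open Finset Equiv Literature.Computability.Complexity

/-! ### Formula gates and the gate type -/

/-- A literal: an atom with a polarity (`true` = positive). -/
abbrev Lit (K r n : ℕ) : Type := Atom K r n × Bool

/-- A width-8 conjunction (`isAnd`) or disjunction of literals. -/
structure N1 (K r n : ℕ) where
  /-- conjunction (`true`) or disjunction -/
  isAnd : Bool
  /-- the literals -/
  ls : Fin 8 → Lit K r n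
  deriving DecidableEq, Fintype

/-- A width-4 conjunction or disjunction of `N1` formulas. -/
structure N2 (K r n : ℕ) where
  /-- conjunction (`true`) or disjunction -/
  isAnd : Bool
  /-- the operands -/
  xs : Fin 4 → N1 K r n
  deriving DecidableEq, Fintype

/-- **The gate type of the window canoniser**: atoms, negated atoms, and the two formula layers. -/
inductive Node (K r n : ℕ)
  /-- an atom -/
  | atom (a : Atom K r n)
  /-- the negation of an atom -/
  | natom (a : Atom K r n)
  /-- a width-8 formula over literals -/
  | f1 (f : N1 K r n)
  /-- a width-4 formula over width-8 formulas -/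
  | f2 (f : N2 K r n)
  deriving DecidableEq, Fintype

/-- The wires: entries of the `(r+n) × (r+n)` input matrix, or gates. -/
abbrev Wire (K r n : ℕ) : Type := (Fin (r + n) × Fin (r + n)) ⊕ Node K r n

namespace N1
variable {K r n : ℕ}
/-- Relabelling acts on every literal. -/
def act (π : Perm (Fin n)) (f : N1 K r n) : N1 K r n := ⟨f.isAnd, fun i => ((f.ls i).1.act π, (f.ls i).2)⟩
/-- `act_isAnd`: bookkeeping/simp lemma (act isAnd). -/
@[simp] theorem act_isAnd (π : Perm (Fin n)) (f : N1 K r n) : (f.act π).isAnd = f.isAnd := rfl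
/-- `act_ls`: bookkeeping/simp lemma (act ls). -/
@[simp] theorem act_ls (π : Perm (Fin n)) (f : N1 K r n) (i : Fin 8) : (f.act π).ls i = ((f.ls i).1.act π, (f.ls i).2) := rfl
/-- `act_inv_act`: bookkeeping/simp lemma (act inv act). -/
@[simp] theorem act_inv_act (π : Perm (Fin n)) (f : N1 K r n) : (f.act π).act π⁻¹ = f := by cases f; simp [act]
/-- `act_act_inv`: bookkeeping/simp lemma (act act inv). -/
@[simp] theorem act_act_inv (π : Perm (Fin n)) (f : N1 K r n) : (f.act π⁻¹).act π = f := by cases f; simp [act]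
end N1

namespace N2
variable {K r n : ℕ}
/-- Relabelling acts on every operand. -/
def act (π : Perm (Fin n)) (f : N2 K r n) : N2 K r n := ⟨f.isAnd, fun i => (f.xs i).act π⟩
/-- `act_isAnd`: bookkeeping/simp lemma (act isAnd). -/
@[simp] theorem act_isAnd (π : Perm (Fin n)) (f : N2 K r n) : (f.act π).isAnd = f.isAnd := rfl
/-- `act_xs`: bookkeeping/simp lemma (act xs). -/
@[simp] theorem act_xs (π : Perm (Fin n)) (f : N2 K r n) (i : Fin 4) : (f.act π).xs i = (f.xs i).act π := rfl
/-- `act_inv_act`: bookkeeping/simp lemma (act inv act). -/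
@[simp] theorem act_inv_act (π : Perm (Fin n)) (f : N2 K r n) : (f.act π).act π⁻¹ = f := by cases f; simp [act]
/-- `act_act_inv`: bookkeeping/simp lemma (act act inv). -/
@[simp] theorem act_act_inv (π : Perm (Fin n)) (f : N2 K r n) : (f.act π⁻¹).act π = f := by cases f; simp [act]
end N2

namespace Node

variable {K r n : ℕ}

/-- Relabelling of gates. -/
def act (π : Perm (Fin n)) : Node K r n → Node K r n
  | atom a => atom (a.act π)
  | natom a => natom (a.act π)
  | f1 f => f1 (f.act π)
  | f2 f => f2 (f.act π)

/-- `act_atom`: bookkeeping/simp lemma (act atom). -/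
@[simp] theorem act_atom (π : Perm (Fin n)) (a : Atom K r n) : (atom a).act π = atom (a.act π) := rfl
/-- `act_natom`: bookkeeping/simp lemma (act natom). -/
@[simp] theorem act_natom (π : Perm (Fin n)) (a : Atom K r n) : (natom a).act π = natom (a.act π) := rfl
/-- `act_f1`: bookkeeping/simp lemma (act f1). -/
@[simp] theorem act_f1 (π : Perm (Fin n)) (f : N1 K r n) : (f1 f).act π = f1 (f.act π) := rfl
/-- `act_f2`: bookkeeping/simp lemma (act f2). -/
@[simp] theorem act_f2 (π : Perm (Fin n)) (f : N2 K r n) : (f2 f).act π = f2 (f.act π) := rfl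

/-- `act_inv_act`: bookkeeping/simp lemma (act inv act). -/
@[simp] theorem act_inv_act (π : Perm (Fin n)) (l : Node K r n) : (l.act π).act π⁻¹ = l := by cases l <;> simp

/-- `act_act_inv`: bookkeeping/simp lemma (act act inv). -/
@[simp] theorem act_act_inv (π : Perm (Fin n)) (l : Node K r n) : (l.act π⁻¹).act π = l := by cases l <;> simp

/-- The action as a permutation of the gates. -/
def actEquiv (π : Perm (Fin n)) : Perm (Node K r n) where
  toFun := act π
  invFun := act π⁻¹
  left_inv := act_inv_act π
  right_inv := act_act_inv π

/-- `actEquiv_apply`: bookkeeping/simp lemma (actEquiv apply). -/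
@[simp] theorem actEquiv_apply (π : Perm (Fin n)) (l : Node K r n) : actEquiv π l = l.act π := rfl

end Node

/-! ### Gate functions -/

/-- Gate function of a shared atom: binary `∨` for literals, the identity `∧₁` for the colour order (a copy
of a formula gate), `MAJ_{2n}` for the neighbour-count comparison, `∧ₙ`, `∨ₙ`. -/
def SKind.fn (n : ℕ) : SKind → GateFn
  | .exV => GateFn.or 2
  | .exO => GateFn.or 2
  | .rLT => GateFn.and 1
  | .rcge => GateFn.maj (n + n)
  | .rallb => GateFn.and n
  | .rlex => GateFn.or n

/-- Gate function of a labelled atom (arity by family; see `…WiringDefs.lean` for the wires). -/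
def Kind.fn (r n : ℕ) : Kind → GateFn
  | .sW => GateFn.and 1
  | .sLT => GateFn.and 1
  | .sC => GateFn.and 1
  | .sARR => GateFn.and 1
  | .sDEAD => GateFn.and 1
  | .frz => GateFn.or 3
  | .now => GateFn.and (n + n)
  | .cnt1 => GateFn.maj (n + n)
  | .sw => GateFn.maj (n * n + n * n + n * n + (n * n + n * n + n * n))
  | .reach => GateFn.or n
  | .conn => GateFn.and (n * n)
  | .szGE => GateFn.maj (n + n)
  | .big => GateFn.maj (n + n)
  | .bmc => GateFn.and (n + 2)
  | .sel => GateFn.and (n + 2)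
  | .hasSel => GateFn.or n
  | .pok => GateFn.and (n * n)
  | .nWs => GateFn.or n
  | .fLT => GateFn.and 1
  | .fcge => GateFn.maj (n + n)
  | .fallb => GateFn.and n
  | .flex => GateFn.or n
  | .rkGE => GateFn.maj (n + n)
  | .mtch => GateFn.and (n + n + n * n)
  | .thru => GateFn.or (T n)
  | .cert => GateFn.and 4
  | .pcand => GateFn.or n
  | .lcrk => GateFn.or n
  | .pfx => GateFn.and (NB r n)
  | .lexLE => GateFn.or (NB r n + 1)
  | .best => GateFn.and (n * (n + 1) + 1)
  | .ivbit => GateFn.or (n * (n + 1))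
  | .inonbot => GateFn.or (n * (n + 1))
  | .isP => GateFn.and n
  | .pcov => GateFn.or (2 ^ n)
  | .pnonbot => GateFn.and n
  | .pbit => GateFn.or (2 ^ n)
  | .rkInGE => GateFn.maj (n + n)
  | .pcP => GateFn.or (n * n)
  | .ppc => GateFn.or (2 ^ n)
  | .pcrk => GateFn.or n
  | .ppfx => GateFn.and (NBp r n)
  | .plexLT => GateFn.or (NBp r n)
  | .pstGE => GateFn.maj (n + n)
  | .pbcGE => GateFn.maj (n + n)
  | .pat => GateFn.or (n + 1)
  | .off => GateFn.or n
  | .blkI => GateFn.or n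
  | .samePart => GateFn.or (n * n)
  | .spc => GateFn.or (n * n)
  | .svadj => GateFn.or (n * n * n + n * n)
  | .svext => GateFn.or (n * n)
  | .svcrk => GateFn.or n
  | .vbit => GateFn.and 1

/-- Shared gate functions lie in `tcBasis`. -/
theorem SKind.fn_mem_tcBasis (n : ℕ) (k : SKind) : k.fn n ∈ tcBasis := by
  cases k <;> first | exact acBasis_subset_tcBasis (and_mem_acBasis _) | exact acBasis_subset_tcBasis (or_mem_acBasis _) | exact maj_mem_tcBasis _

/-- Labelled gate functions lie in `tcBasis`. -/
theorem Kind.fn_mem_tcBasis (r n : ℕ) (k : Kind) : k.fn r n ∈ tcBasis := by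
  cases k <;> first | exact acBasis_subset_tcBasis (and_mem_acBasis _) | exact acBasis_subset_tcBasis (or_mem_acBasis _) | exact maj_mem_tcBasis _

namespace Atom
variable {K r n : ℕ}
/-- Gate function of an atom (`∧₀ = tt`, `∨₀ = ff`, `∨₂` for outside literals, `∨ₙ` for outputs). -/
def fn : Atom K r n → GateFn
  | tt => GateFn.and 0
  | ff => GateFn.or 0
  | oo _ _ => GateFn.or 2
  | outv _ => GateFn.or n
  | sh k _ => k.fn n
  | lab _ k _ => k.fn r n

/-- Gate functions are invariant under relabelling. -/
@[simp] theorem fn_act (π : Perm (Fin n)) (a : Atom K r n) : (a.act π).fn = a.fn := by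
  cases a <;> simp [fn, act, Kind.fn]

/-- Gate functions of atoms lie in `tcBasis`. -/
theorem fn_mem_tcBasis (a : Atom K r n) : a.fn ∈ tcBasis := by
  cases a with
  | tt => exact acBasis_subset_tcBasis (and_mem_acBasis _)
  | ff => exact acBasis_subset_tcBasis (or_mem_acBasis _)
  | oo o o' => exact acBasis_subset_tcBasis (or_mem_acBasis _)
  | outv b => exact acBasis_subset_tcBasis (or_mem_acBasis _)
  | sh k P => exact SKind.fn_mem_tcBasis n k
  | lab L k P => exact Kind.fn_mem_tcBasis r n k
end Atom

/-- The gate function of a formula gate of width `k`: `∧ₖ` (`isAnd`) or `∨ₖ`, with arity `k` by `rfl`. -/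
def fgate (isAnd : Bool) (k : ℕ) : GateFn :=
  ⟨k, fun v => if isAnd then decide (∀ i, v i = true) else decide (∃ i, v i = true)⟩

/-- `fgate true k = ∧ₖ`. -/
@[simp] theorem fgate_true (k : ℕ) : fgate true k = GateFn.and k := rfl

/-- `fgate false k = ∨ₖ`. -/
@[simp] theorem fgate_false (k : ℕ) : fgate false k = GateFn.or k := rfl

/-- Formula gate functions lie in `tcBasis`. -/
theorem fgate_mem_tcBasis (b : Bool) (k : ℕ) : fgate b k ∈ tcBasis := by
  cases b
  · rw [fgate_false]; exact acBasis_subset_tcBasis (or_mem_acBasis k)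
  · rw [fgate_true]; exact acBasis_subset_tcBasis (and_mem_acBasis k)

namespace Node
variable {K r n : ℕ}

/-- **Gate functions**: atoms by family; negated atoms `¬`; formulas `∧₈/∨₈` and `∧₄/∨₄`. -/
def fn : Node K r n → GateFn
  | atom a => a.fn
  | natom _ => GateFn.not
  | f1 f => fgate f.isAnd 8
  | f2 f => fgate f.isAnd 4

/-- Gate functions are invariant under relabelling. -/
@[simp] theorem fn_act (π : Perm (Fin n)) (l : Node K r n) : (l.act π).fn = l.fn := by
  cases l <;> simp [fn]

/-- **All gate functions lie in the threshold basis.** -/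
theorem fn_mem_tcBasis (l : Node K r n) : l.fn ∈ tcBasis := by
  cases l with
  | atom a => exact a.fn_mem_tcBasis
  | natom a => exact not_mem_tcBasis
  | f1 f => exact fgate_mem_tcBasis _ _
  | f2 f => exact fgate_mem_tcBasis _ _

/-- All gate functions are symmetric Boolean functions. -/
theorem fn_isSymmetric (l : Node K r n) : l.fn.IsSymmetric := isSymmetric_of_mem_tcBasis (fn_mem_tcBasis l)

end Node

end WCan

end Summit.PneNP.PneNP.Theorems
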